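import Summits.AtomisticToContinuum.Crystallization.Theorems.FreeSplittingCertificatesStrictSplittingRuleP1SiteLedger
import Summits.AtomisticToContinuum.Crystallization.Theorems.FreeSplittingCertificatesStrictSplittingRuleP1FarLedgerExact

/-!
# `StrictSplittingRule` (stmt-AtomisticToContinuum-12560): THE SITE LEDGER with the per-cell budget in EXACT-DEFECT form (P1 interpolant object, part 70)

Route `FreeSplittingCertificates`, crux r3 `StrictSplittingRule` (H12⋆ = `stub_coreJointCoercive`), unit b2b-freesplit-B gen 34.
VALUE = part 56 (`coreJointSiteIneq_of_ledgers`) RE-THREADED on part 69: `CoreJointSiteIneq a h κ₁ κ₃ Y₁ β p1BondOffsets M N u p` at a representative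
site from (hB) the per-cell budget with the EXACT vertex-quadrature defect `p1CellDefectG` (the statement `cellval.py` certifies, HOME CERT §31/§34)
and (hNear) the near-ledger inequality — no circumradius data.  Proof = part 56's with `farLedger_le_of_cellBudget_exact`.
NOT a proof of H12⋆ (two certificate-tier hypotheses), NOT summit progress.  [folklore]
-/

noncomputable section

open Set Function Metric MeasureTheory Filter Topology
open scoped BigOperators NNReal ENNReal Classical

namespace Summit.AtomisticToContinuum.Crystallization.Theorems.StrictSplittingRuleBirth

open Literature.MathematicalPhysics.StatisticalMechanics
open Summit.AtomisticToContinuum.Crystallization.Theorems.PalmUnimodularRigidity.LayeredLawsSelectHcp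

/-- **THE SITE LEDGER (exact defect)**: `CoreJointSiteIneq` at `p` from the per-cell budget (B) in exact-defect form and the near-ledger inequality.
NOT a proof of H12⋆, NOT summit progress. -/
theorem coreJointSiteIneq_of_ledgers_exact {a h κ₁ κ₃ : ℝ} (ha : 0 < a) (hh : 0 < h) (hfam : HcpFamilyMin a h)
    (Y₁ : Finset (ℤ × ℤ × ℤ)) (β : Bool → (ℤ × ℤ × ℤ) → (ℤ × ℤ × ℤ) → ℝ)
    (M₁ M N : Bool → (ℤ × ℤ × ℤ) → (ℤ × ℤ × ℤ) → (ℤ × ℤ × ℤ) → ℝ)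
    {R1 R2 : ℝ} (hR1 : 0 < R1) (hR12 : R1 < R2) {κ : ℝ} (hκ : 0 ≤ κ)
    (hM : ∀ b e s s', M b e s s' = M₁ b e s s' + (fun b e s s' => if s = s' then -(κ * (2 / 5) / a ^ 4 * p1RecTable a h (p1SplitDensity R1 R2) b e s) else 0) b e s s')
    (u : ℤ × ℤ × ℤ → EuclideanSpace ℝ (Fin 3)) (hu : (support u).Finite) (p : ℤ × ℤ × ℤ)
    (hTR₁ : Summable fun q : ℤ × ℤ × ℤ => if q = p then (0 : ℝ) else
        ∑ s ∈ p1BondOffsets, ∑ s' ∈ p1BondOffsets,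
          (M₁ (decide (Even p.1)) (q - p) s s' *
              (inner ℝ (hcpSite a h (p + s) - hcpSite a h p) (u (p + s) - u p) *
                inner ℝ (hcpSite a h (p + s') - hcpSite a h p) (u (p + s') - u p)) -
            M₁ (decide (Even q.1)) (p - q) s s' *
              (inner ℝ (hcpSite a h (q + s) - hcpSite a h q) (u (q + s) - u q) *
                inner ℝ (hcpSite a h (q + s') - hcpSite a h q) (u (q + s') - u q)) +
            (N (decide (Even p.1)) (q - p) s s' - N (decide (Even q.1)) (p - q) s' s) *
              (inner ℝ (hcpSite a h (p + s) - hcpSite a h p) (u (p + s) - u p) *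
                inner ℝ (hcpSite a h (q + s') - hcpSite a h q) (u (q + s') - u q))))
    -- in-layer far shares and their allocation table
    (w : (ℤ × ℤ × ℤ) × (ℤ × ℤ × ℤ) → ℝ) (hw : ∀ e, 0 ≤ w e)
    (hws : Summable fun e : (ℤ × ℤ × ℤ) × (ℤ × ℤ × ℤ) => w e * fpSq (fun k => hcpSite a h (e.1 + e.2) k - hcpSite a h e.1 k))
    (θ : (ℤ × ℤ × ℤ) × (ℤ × ℤ × ℤ) → (ℤ × ℤ × ℤ) × Fin 6 → ℝ) (hθ : ∀ e T, 0 ≤ θ e T)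
    (hfinE : ∀ e, (Function.support (θ e)).Finite) (hfinC : ∀ T, (Function.support fun e => θ e T).Finite)
    (hsum : ∀ e, w e ≠ 0 → ∑ᶠ T, θ e T = 1)
    (hcar : ∀ e T, θ e T ≠ 0 → ∃ m m' : Fin 4, e.1 = T.1 + p1VertOff (p1Par T.1) T.2 m ∧
      e.1 + e.2 = T.1 + p1VertOff (p1Par T.1) T.2 m')
    -- vertical far shares, routing offsets and their allocation table (unit row sums on the support of the routed leg weight)
    (sv : ℤ × ℤ × ℤ) (o : (ℤ × ℤ × ℤ) → Fin 3 → ℤ × ℤ × ℤ) (S : Finset (ℤ × ℤ × ℤ)) (ho : ∀ q i, o q i ∈ S)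
    (wv : ℤ × ℤ × ℤ → ℝ) (hwv : ∀ q, 0 ≤ wv q) (hwvs : Summable wv)
    (θv : (ℤ × ℤ × ℤ) × (ℤ × ℤ × ℤ) → (ℤ × ℤ × ℤ) × Fin 6 → ℝ) (hθv : ∀ e T, 0 ≤ θv e T)
    (hfinEv : ∀ e, (Function.support (θv e)).Finite) (hfinCv : ∀ T, (Function.support fun e => θv e T).Finite)
    (hsumv : ∀ e, (∑ i : Fin 3, (2 / 3) * ((if e.2 = o e.1 i then wv e.1 else 0) +
        (if o (e.1 - (sv - e.2)) i = sv - e.2 then wv (e.1 - (sv - e.2)) else 0))) ≠ 0 → ∑ᶠ T, θv e T = 1)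
    (hcarv : ∀ e T, θv e T ≠ 0 → ∃ m m' : Fin 4, e.1 = T.1 + p1VertOff (p1Par T.1) T.2 m ∧
      e.1 + e.2 = T.1 + p1VertOff (p1Par T.1) T.2 m')
    -- THE PER-CELL BUDGET (B): dyad readout + EXACT defect form (part 68), weights re-centred at `y_p`
    (hB : ∀ (T : (ℤ × ℤ × ℤ) × Fin 6) (G : Fin 3 → Fin 3 → ℝ),
      (∑ᶠ e : (ℤ × ℤ × ℤ) × (ℤ × ℤ × ℤ), θ e T * w e *
          fpSq (fun k => (hcpSite a h (e.1 + e.2) 0 - hcpSite a h e.1 0) * G 0 k +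
            (hcpSite a h (e.1 + e.2) 1 - hcpSite a h e.1 1) * G 1 k + (hcpSite a h (e.1 + e.2) 2 - hcpSite a h e.1 2) * G 2 k)) +
      (∑ᶠ e : (ℤ × ℤ × ℤ) × (ℤ × ℤ × ℤ), θv e T *
          (∑ i : Fin 3, (2 / 3) * ((if e.2 = o e.1 i then wv e.1 else 0) +
            (if o (e.1 - (sv - e.2)) i = sv - e.2 then wv (e.1 - (sv - e.2)) else 0))) *
          fpSq (fun k => (hcpSite a h (e.1 + e.2) 0 - hcpSite a h e.1 0) * G 0 k +
            (hcpSite a h (e.1 + e.2) 1 - hcpSite a h e.1 1) * G 1 k + (hcpSite a h (e.1 + e.2) 2 - hcpSite a h e.1 2) * G 2 k)) +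
      p1CellDefectG a h (fun y k l => κ * ((7 * (5 / 4 : ℝ) + 3 / 4) / 4) * fpChi (R1 ^ 2) (R2 ^ 2) (y - fun k => hcpSite a h p k) ^ 2 *
          (fpSq (y - fun k => hcpSite a h p k))⁻¹ ^ 5 * ((y - fun k => hcpSite a h p k) k * (y - fun k => hcpSite a h p k) l)) T G ≤
      κ * ((5 / 2 * (1 / 24 * fpSymSq G) + 5 / 2 * (1 / 24 * (fpFrob G - fpSymSq G))) *
        ∫ y in p1RealCell a h T, fpChi (R1 ^ 2) (R2 ^ 2) (y - fun k => hcpSite a h p k) ^ 2 * (fpSq (y - fun k => hcpSite a h p k))⁻¹ ^ 3))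
    -- THE NEAR-LEDGER INEQUALITY (certificate tier + identification, G9): for every skew least-squares co-rotation and its matrix
    (hNear : ∀ (W : EuclideanSpace ℝ (Fin 3) →ₗ[ℝ] EuclideanSpace ℝ (Fin 3)),
      (∀ z : EuclideanSpace ℝ (Fin 3), inner ℝ (W z) z = 0) →
      (∀ W' : EuclideanSpace ℝ (Fin 3) →ₗ[ℝ] EuclideanSpace ℝ (Fin 3), (∀ z : EuclideanSpace ℝ (Fin 3), inner ℝ (W' z) z = 0) →
        (∑' q : ℤ × ℤ × ℤ,
            (if 0 < ‖hcpSite a h q - hcpSite a h p‖ ∧ ‖hcpSite a h q - hcpSite a h p‖ ≤ 11 / 10 * a then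
              ‖u q - u p - W (hcpSite a h q - hcpSite a h p)‖ ^ 2 else (0 : ℝ))) ≤
        (∑' q : ℤ × ℤ × ℤ,
            (if 0 < ‖hcpSite a h q - hcpSite a h p‖ ∧ ‖hcpSite a h q - hcpSite a h p‖ ≤ 11 / 10 * a then
              ‖u q - u p - W' (hcpSite a h q - hcpSite a h p)‖ ^ 2 else (0 : ℝ)))) →
      ∀ (A : Fin 3 → Fin 3 → ℝ), (∀ (y : EuclideanSpace ℝ (Fin 3)) (k : Fin 3), W y k = y 0 * A 0 k + y 1 * A 1 k + y 2 * A 2 k) →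
      κ₁ * (∑' q : ℤ × ℤ × ℤ,
        (if 0 < ‖hcpSite a h q - hcpSite a h p‖ ∧ ‖hcpSite a h q - hcpSite a h p‖ ≤ 11 / 10 * a then
          (inner ℝ (hcpSite a h q - hcpSite a h p) (u q - u p)) ^ 2 else (0 : ℝ))) +
      κ₃ * (∑' q : ℤ × ℤ × ℤ,
        (if 0 < ‖hcpSite a h q - hcpSite a h p‖ ∧ ‖hcpSite a h q - hcpSite a h p‖ ≤ 11 / 10 * a then
          ‖u q - u p - W (hcpSite a h q - hcpSite a h p)‖ ^ 2 else (0 : ℝ))) +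
      (∑' q : ℤ × ℤ × ℤ, (if q = p then (0 : ℝ) else
        ∑ s ∈ Y₁,
          (β (decide (Even q.1)) (p - q) s *
              (1 / 2 * ‖u (q + s) - u q - W (hcpSite a h (q + s) - hcpSite a h q)‖ ^ 2) -
            β (decide (Even p.1)) (q - p) s *
              (1 / 2 * ‖u (p + s) - u p - W (hcpSite a h (p + s) - hcpSite a h p)‖ ^ 2)))) -
      ((∑' e : (ℤ × ℤ × ℤ) × (ℤ × ℤ × ℤ), w e * ‖u (e.1 + e.2) - u e.1 - W (hcpSite a h (e.1 + e.2) - hcpSite a h e.1)‖ ^ 2) +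
    (∑' q : ℤ × ℤ × ℤ, wv q * ‖u (q + sv) - u q - W (hcpSite a h (q + sv) - hcpSite a h q)‖ ^ 2) +
    (∑' q, p1SiteBare a h (fun y k l => κ * ((7 * (5 / 4 : ℝ) + 3 / 4) / 4) * fpChi (R1 ^ 2) (R2 ^ 2) (y - fun k => hcpSite a h p k) ^ 2 *
        (fpSq (y - fun k => hcpSite a h p k))⁻¹ ^ 5 * ((y - fun k => hcpSite a h p k) k * (y - fun k => hcpSite a h p k) l))
        (fun n k => p1DispSite a h (fun n k => u n k) (fun k => u p k - (hcpSite a h p 0 * A 0 k + hcpSite a h p 1 * A 1 k + hcpSite a h p 2 * A 2 k)) A n k) q) -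
    (∑' q, p1SiteBare a h (fun y k l => κ * ((3 / 4 : ℝ) / 4) * fpChi (R1 ^ 2) (R2 ^ 2) (y - fun k => hcpSite a h p k) ^ 2 *
        (fpSq (y - fun k => hcpSite a h p k))⁻¹ ^ 4 * (if k = l then 1 else 0))
        (fun n k => p1DispSite a h (fun n k => u n k) (fun k => u p k - (hcpSite a h p 0 * A 0 k + hcpSite a h p 1 * A 1 k + hcpSite a h p 2 * A 2 k)) A n k) q)) -
      (∑' q : ℤ × ℤ × ℤ, (if q = p then (0 : ℝ) else
        1 / 2 * (ljSqDeriv (‖hcpSite a h q - hcpSite a h p‖ ^ 2) *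
            ‖u q - u p - W (hcpSite a h q - hcpSite a h p)‖ ^ 2 +
          2 * (1 / 2 * (7 * ((‖hcpSite a h q - hcpSite a h p‖ ^ 2)⁻¹) ^ 8 -
            4 * ((‖hcpSite a h q - hcpSite a h p‖ ^ 2)⁻¹) ^ 5)) *
            (inner ℝ (hcpSite a h q - hcpSite a h p) (u q - u p)) ^ 2))) -
      (∑' q : ℤ × ℤ × ℤ, (if q = p then (0 : ℝ) else
        ∑ s ∈ p1BondOffsets, ∑ s' ∈ p1BondOffsets,
          (M₁ (decide (Even p.1)) (q - p) s s' *
              (inner ℝ (hcpSite a h (p + s) - hcpSite a h p) (u (p + s) - u p) *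
                inner ℝ (hcpSite a h (p + s') - hcpSite a h p) (u (p + s') - u p)) -
            M₁ (decide (Even q.1)) (p - q) s s' *
              (inner ℝ (hcpSite a h (q + s) - hcpSite a h q) (u (q + s) - u q) *
                inner ℝ (hcpSite a h (q + s') - hcpSite a h q) (u (q + s') - u q)) +
            (N (decide (Even p.1)) (q - p) s s' - N (decide (Even q.1)) (p - q) s' s) *
              (inner ℝ (hcpSite a h (p + s) - hcpSite a h p) (u (p + s) - u p) *
                inner ℝ (hcpSite a h (q + s') - hcpSite a h q) (u (q + s') - u q))))) +
      κ * (2 / 5) / a ^ 4 * (∑' q : ℤ × ℤ × ℤ, if q = p then (0 : ℝ) else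
        ∑ s ∈ p1BondOffsets, p1RecTable a h (p1SplitDensity R1 R2) (decide (Even p.1)) (q - p) s *
          (inner ℝ (hcpSite a h (p + s) - hcpSite a h p) (u (p + s) - u p)) ^ 2) +
      κ * (2 / 5) / a ^ 4 * (∑ d ∈ p1BondOffsets, p1RecTable a h (p1SplitDensity R1 R2) (p1Par p) (p - p) d *
          (inner ℝ (hcpSite a h (p + d) - hcpSite a h p) (u (p + d) - u p)) ^ 2) +
      κ * (∑' i, p1FluxQuad₀ (R1 ^ 2) (R2 ^ 2) (1 / 3) (4 / 3) (-9 / 8) (1 / 8) a h (fun k => hcpSite a h p k) i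
        (p1CellVals (fun n k => p1DispSite a h (fun n k => u n k) (fun k => u p k - (hcpSite a h p 0 * A 0 k + hcpSite a h p 1 * A 1 k + hcpSite a h p 2 * A 2 k)) A n k) i)) ≤ 0) :
    CoreJointSiteIneq a h κ₁ κ₃ Y₁ β p1BondOffsets M N u p := by
  have ha' := ha.ne'
  have hh' := hh.ne'
  obtain ⟨W, hWskew, hWLS⟩ := stub_leastSquaresRotationExists a h ha hh u p
  obtain ⟨A, hA⟩ := exists_p1Matrix W
  have hnear := hNear W hWskew hWLS A hA
  have hfar := farLedger_le_of_cellBudget_exact ha hh hfam u hu W hWskew A hA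
    (fun k => u p k - (hcpSite a h p 0 * A 0 k + hcpSite a h p 1 * A 1 k + hcpSite a h p 2 * A 2 k)) p hR1 hR12 hκ
    w hw hws θ hθ hfinE hfinC hsum hcar sv o S ho wv hwv hwvs θv hθv hfinEv hfinCv hsumv hcarv hB
  -- the far table: payment identity and decay
  obtain ⟨C, hC⟩ := p1RecTable_fpChi_decay ha hh hR1 hR12
  have hRdec : ∀ p' q : ℤ × ℤ × ℤ, ∀ s, |p1RecTable a h (p1SplitDensity R1 R2) (decide (Even p'.1)) (q - p') s| ≤
      C * ((1 + ‖hcpSite a h q - hcpSite a h p'‖)⁻¹) ^ 6 := by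
    intro p' q s
    have h1 := (hC q p' s).2
    rw [norm_sub_rev] at h1
    exact h1
  have hpay := farTable_transfer_eq_receipts_sub_payments (t := κ * (2 / 5) / a ^ 4) ha hh p1BondOffsets
    (p1RecTable a h (p1SplitDensity R1 R2)) (fun b e s s' => if s = s' then -(κ * (2 / 5) / a ^ 4 * p1RecTable a h (p1SplitDensity R1 R2) b e s) else 0) (fun _ _ _ _ => (0 : ℝ))
    (fun b e s s' => rfl) (fun b e s s' => rfl) hRdec u hu p
  obtain ⟨_, _, hTRfar_s, hTRfar⟩ := hpay
  -- TR(M, N) = TR(M₁, N) + TR(M_far, 0)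
  have htr := coreJoint_transfer_add (a := a) (h := h) p1BondOffsets M₁ N (fun b e s s' => if s = s' then -(κ * (2 / 5) / a ^ 4 * p1RecTable a h (p1SplitDensity R1 R2) b e s) else 0) (fun _ _ _ _ => (0 : ℝ)) M N hM
    (fun b e s s' => by simp) u p hTR₁ hTRfar_s
  obtain ⟨_, hTR⟩ := htr
  -- the receipts series split at q = p
  obtain ⟨hlo, hhi⟩ := ratioBox_of_hcpFamilyMin ha hh hfam
  have hU : (support fun n => fun k => u n k).Finite := by
    refine hu.subset fun n hn => ?_
    simp only [mem_support, ne_eq] at hn ⊢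
    intro h0
    apply hn
    funext k
    rw [h0]
    rfl
  have hRECs := (farReceipts_le_tsum_table ha hlo hhi (fun n k => u n k) hU (fun k => u p k - (hcpSite a h p 0 * A 0 k + hcpSite a h p 1 * A 1 k + hcpSite a h p 2 * A 2 k)) A p hR1 hR12).1
  simp only [p1Str_eq_inner_of_skew ha' hh' u W hWskew A hA] at hRECs
  have hsplit := hRECs.tsum_eq_add_tsum_ite p
  have hsplit' := congrArg (fun x : ℝ => κ * (2 / 5) / a ^ 4 * x) hsplit
  simp only [mul_add] at hsplit'
  -- conclude
  unfold CoreJointSiteIneq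
  refine ⟨W, hWskew, hWLS, ?_⟩
  rw [hTR, hTRfar]
  have hP : ∀ q : ℤ × ℤ × ℤ, p1Par q = decide (Even q.1) := fun q => rfl
  simp only [hP] at hfar hsplit' hnear
  linarith [hnear, hfar, hsplit']

end Summit.AtomisticToContinuum.Crystallization.Theorems.StrictSplittingRuleBirth

end
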